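import Mathlib
import Summits.Ventures.HodgeRepro2.Tier7.Line3.NumberFieldHyperbolicCount

/-!
# Tier7/Line3/CountBoundInjOn — the `count_bound` field with `κ` injective only on the orbits carrying weight (seat t7-L1-p4)

LINE 3 (t7-plan-3), version (ii). p5's `CountBoundOfKappa.count_bound_of_kappa` (p671204) derives the `count_bound`
field of p1's `DominantSide` (row 674) from a κ-dictionary with `hκ : Function.Injective κ` on ALL of `Orb`. crit-2's
record (v) at STATUS l. 15064: on the real objects «one double coset per REGULAR value» (p1's `TwoTorusInvariant`) is
injectivity of `κ` on the regular double cosets only — the degenerate `γ` (`κ ∈ {0, 1}`) are the case to watch —, so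
either `Orb` is the set of regular double cosets or the field must be instantiated with that subset. THIS FILE removes
the choice: `count_bound_of_kappa_injOn` asks only `hκ : ∀ N, Set.InjOn κ {γ | arith N γ}` — `κ` injective on the
orbits carrying weight at each level — and concludes the field verbatim. The counted set at level `N` and size `R` is
`{γ | arith N γ ∧ κ γ − κ₀ ∈ s}` for p5's finset `s` of `NumberFieldHyperbolicCount.exists_finset_rpow` (p670521);
it is finite because `γ ↦ κ γ − κ₀` is injective on it with image inside `s` (`Set.Finite.of_finite_image`), and its
card is `≤ s.card` (`Finset.card_le_card_of_injOn`). p5's theorem is the special case `hκ := fun _ => hκ.injOn`.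

Nothing here is about a group, a double coset, an orbital integral or a period; nothing about (N) / the step; no
device. No sorry; axioms ⊆ {propext, Classical.choice, Quot.sound}.
-/

namespace Summit.Ventures.HodgeRepro2.Tier7.Line3.CountBoundInjOn

open NumberField Summit.Ventures.HodgeRepro2.Tier7.Line3.NumberFieldHyperbolicCount

variable {K : Type*} [Field K] [NumberField K]

/-- **`count_bound` from a κ-dictionary with `κ` injective only on the orbits carrying weight**: with
`size γ = (1 + |κ γ − κ₀|_{w₂})(1 + |κ γ − κ₀|_{w₃})` and `β = 1 + ε`, uniform in the level `N`. -/
theorem count_bound_of_kappa_injOn (hK : ∀ w : InfinitePlace K, w.IsReal) (M : K) (hM : M ≠ 0)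
    {w₂ w₃ : InfinitePlace K} (hw : w₂ ≠ w₃) {ε : ℝ} (hε : 0 < ε) {B : ℝ} (hB : 0 ≤ B)
    {Orb : Type*} (κ : Orb → K) (κ₀ : K) (arith : ℕ → Orb → Prop)
    (hκ : ∀ N, Set.InjOn κ {γ | arith N γ})
    (hdict : ∀ N γ, arith N γ → IsIntegral ℤ (M * (κ γ - κ₀)) ∧
      ∀ w : InfinitePlace K, w ≠ w₂ → w ≠ w₃ → w (κ γ - κ₀) ≤ B) :
    ∃ C' : ℝ, ∀ N (R : ℝ), 0 ≤ R → ∃ s : Finset Orb,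
      (∀ γ, arith N γ → (1 + w₂ (κ γ - κ₀)) * (1 + w₃ (κ γ - κ₀)) ≤ R → γ ∈ s) ∧
      (s.card : ℝ) ≤ C' * (1 + R) ^ (1 + ε) := by
  classical
  obtain ⟨C, _, hC⟩ := exists_finset_rpow hK M hM hw hε hB
  refine ⟨C, fun N R hR => ?_⟩
  by_cases hR1 : 1 ≤ R
  · obtain ⟨s, hs_mem, hs_card⟩ := hC R hR1
    -- the counted set: the orbits carrying weight at level `N` whose invariant lies in `s`
    let f : Orb → K := fun γ => κ γ - κ₀
    let A : Set Orb := {γ | arith N γ ∧ f γ ∈ s}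
    have hinj : Set.InjOn f A := fun γ hγ γ' hγ' h =>
      hκ N hγ.1 hγ'.1 (sub_left_injective h)
    have hA : A.Finite :=
      Set.Finite.of_finite_image (s.finite_toSet.subset fun y ⟨γ, hγ, hy⟩ => hy ▸ hγ.2) hinj
    refine ⟨hA.toFinset, fun γ hγ hsize => ?_, ?_⟩
    · rw [Set.Finite.mem_toFinset]
      exact ⟨hγ, hs_mem _ ⟨(hdict N γ hγ).1, (hdict N γ hγ).2, hsize⟩⟩
    · have h1 : hA.toFinset.card ≤ s.card := by
        refine Finset.card_le_card_of_injOn f (fun γ hγ => ?_) ?_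
        · exact ((Set.Finite.mem_toFinset hA).1 hγ).2
        · intro γ hγ γ' hγ' h
          exact hinj ((Set.Finite.mem_toFinset hA).1 hγ) ((Set.Finite.mem_toFinset hA).1 hγ') h
      calc (hA.toFinset.card : ℝ) ≤ (s.card : ℝ) := by exact_mod_cast h1
        _ ≤ C * (1 + R) ^ (1 + ε) := hs_card
  · -- `R < 1`: the size is always `≥ 1`, so the set is empty
    refine ⟨∅, fun γ _ hsize => ?_, ?_⟩
    · exfalso
      have h2 : 1 ≤ 1 + w₂ (κ γ - κ₀) := by have := apply_nonneg w₂ (κ γ - κ₀); linarith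
      have h3 : 1 ≤ 1 + w₃ (κ γ - κ₀) := by have := apply_nonneg w₃ (κ γ - κ₀); linarith
      have : (1 : ℝ) ≤ (1 + w₂ (κ γ - κ₀)) * (1 + w₃ (κ γ - κ₀)) := by nlinarith
      exact hR1 (this.trans hsize)
    · simp only [Finset.card_empty, Nat.cast_zero]
      positivity

omit [Field K] [NumberField K] in
/-- p5's `count_bound_of_kappa` hypothesis `Function.Injective κ` is the special case of `hκ`. -/
theorem injOn_of_injective {Orb : Type*} (κ : Orb → K) (hκ : Function.Injective κ)
    (arith : ℕ → Orb → Prop) : ∀ N, Set.InjOn κ {γ | arith N γ} :=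
  fun _ => hκ.injOn

end Summit.Ventures.HodgeRepro2.Tier7.Line3.CountBoundInjOn
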